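import Literature.Claims.NS.ClayVariants
import Literature.Analysis.FluidPDE.ClassicalSolutionRescale
import HarnessLib

/-!
# Claim skeleton (D-0090 NS-CLAIMS, C34): Chadwick, arXiv:2305.14219v2 (2026) — «Existence and
# Smoothness of the Navier-Stokes equation using the Boundary Integral Method»

Typed skeleton of E. Chadwick, *Existence and Smoothness of the Navier-Stokes equation using the
Boundary Integral Method*, arXiv:2305.14219 **v2** [math.AP], 29 Jun 2026, 30 pp. (TEXT OF RECORD; bib
`Chadwick2023`; v1 of 23 May 2023, 36 pp., additionally claimed uniqueness in the smooth class — dropped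
in v2; TeX source, PDF and per-page text held in `run/shared/lean/pub/ns-claims/sources/Chadwick2023/`,
LOCATORS.md by ns-claims-lit-2). No journal version, not withdrawn. UNREFEREED CLAIM under adjudication —
NOTHING in this file asserts a step: the paper's statements are `def … : Prop`; the theorems are kernel
relations only (composition, the Clay link, the iteration bookkeeping of §8, and one tautology recording
the literal «proof by ansatz» sentence). `p. N` = v2 PDF page, `(n)` = printed equation number, TeX labels
and TeX line numbers `l. N` of `v2-2026-06-29-chadwick.tex` in brackets.

## The claimed statement (Theorem 1, p. 5, l. 506–517, verbatim)

"Consider the motion of a fluid in `ℝ³` described by the incompressible Navier-Stokes equation and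
continuity equation, such that body forces are taken to be zero, for the unknown velocity field `∈ ℝ³`
and pressure `∈ ℝ` defined for time `t ≥ 0`, with initial condition given for the velocity as a `C^∞`
divergence free vector field that decays like a stokeslet in the far-field. Then, the pressure and
velocity exist and are smooth at all subsequent time with bounded energy." The system is (4) p. 7
[GE:NavStokes]: `uᵢ,₀ + uⱼuᵢ,ⱼ + p,ᵢ − ν uᵢ,ⱼⱼ = 0`, `uᵢ,ᵢ = 0`, `ν = μ/ρ > 0` "the kinematic
viscosity … the only parameter" (l. 716–717). "This theorem requires the following two lemmas" (p. 5):
**Lemma 1** (pp. 5–6, l. 521–577; "Proof. Given in Sections 3-7"): the problem restated as a space-time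
boundary-value problem; "A proof by ansatz is considered. So, in this domain it is assumed that the
velocity and pressure (and therefore the nslet velocity and pressure also) are `C^∞` smooth. This
enables a solution for the velocity to be found by a Green's integral representation. From this solution
it is then shown that a velocity and pressure which are `C^∞` smooth exist, completing the proof by
ansatz"; the representation (1) p. 6: `u_k(x,t) = −∫_V uᵢ(x′,0) u_{ki}(x−x′,t) dV′`, "where `u_{ki}` is the
`i`th velocity component of the `k`th nslet and is chosen to be aligned to the fluid direction at its
origin" — the nslets being the (non-unique, l. 813–816) solutions of the FULL Navier–Stokes system with a
space-time point force, (5) p. 8 [GE:NS], decaying in the far field, which near their origin "approach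
the eulerlet" (14) p. 10 [ER:eulerlet-velocity] (singular like `R⁻³`, `R` measured "from a co-ordinate
system that is a moving reference frame … [which] must move with the fluid velocity at that point",
l. 888–893) and far away the unsteady stokeslet (20)–(21) p. 13. **Lemma 2** (p. 7, (2), l. 583–592;
"Proof. Given in Section 8"): "From this, the velocity is then given by
`u_k(x^L,T) = u_k(x^L,0)(1 + O(ν√T))`, where `x^L` is the Lagrangian co-ordinate position moving with the
fluid having viscosity `ν`, for some small time `ν√T`. Once this is established, it follows that the
solution exists and is smooth for all time `t`."

RENDERING. Physical space `ℝ³ = EuclideanSpace ℝ (Fin 3)`; solutions are the tree's classical solutions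
`IsClassicalNSSolutionOn S ν 0 u p` (jointly `C^∞` velocity and pressure, momentum and continuity
equations pointwise, one-sided time derivative within `S`). "Decays like a stokeslet in the far-field":
the paper's far field is the unsteady stokeslet's, `u ~ u^S ~ 1/R″³` (§6.2 p. 20–21, l. 1580–1581; used in
(41)–(42) and on p. 23 only as an upper bound), rendered as `(1 + ‖x‖)^{3+n} ‖Dⁿu₀(x)‖ ≤ Kₙ` for every
derivative order `n` (`HasStokesletDecay`; the far-field stokeslet profile decays with all its derivatives;
TODO(general form): the `n = 0` clause alone is the literal sentence — the rendering NARROWS the data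
class, i.e. weakens the typed claim, never strengthens it). Every Clay datum (4) is a datum
(`isDatum_of_clay`). "The Lagrangian co-ordinate position moving with the fluid" = any path `X` with
`X′(t) = u(t, X(t))` within the time slab (`IsTrajectoryOn`, the hypothesis form of the tree's
`particleTrajectoryMap`). The ANSATZ CLASS over which Lemma 1/Lemma 2 are derived ("assumed … `C^∞`
smooth", l. 554–556, with the far-field boundary condition "over the far-field spherinder hypersurface
`∂Σ_X` the flow field behaves like a stokeslet", l. 543–544, at all times of the slab) is
`IsSolutionOn S ν u p`: classical on `S` with stokeslet decay of every time slice.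

## Clay delta (reference `Literature.Claims.NS.ClayVariants`)

Nearest Clay statement: (A). Δ1 domain `ℝ³` ("exterior space-time domain … no bodies" = whole space) =;
Δ2 equations (4) = Fefferman (1)–(3) =; Δ3 force `f ≡ 0` =; Δ4 data: `C^∞`, divergence free, stokeslet
decay `O(|x|^{−3−|α|})` ⊋ Clay (4) (Schwartz-type) — the claim admits MORE data, STRONGER; Δ5 solution
class: `C^∞` on `ℝ³ × [0,∞)` = (6), "with bounded energy" = (7) verbatim; Δ7 `ν > 0` fixed but arbitrary
= "Take `ν > 0`"; horizon `[0,∞)` =. Hence `clay_of_claimed : ClaimedTheorem → ClayVariants.clayR3.Regularity`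
is PROVED below (Clay datum ⇒ datum; bridge `isNavierStokesSolution_and_smooth_iff`; energy clause
verbatim): NO wrong-problem axis. (v1's extra uniqueness claim is not part of the text of record.)

## ORDERED STEP INDEX (dependency order = the order `claim_of_steps` takes its hypotheses)

* Step 1 = `Step_1` — Lemma 1, the nslet representation (1) p. 6 = (44)/(45) pp. 21–22 [MP:IVP,
  MP:IVPwithfunvar], proof §§3–7 (Green's identity (30) p. 16 [BI:formulation] in the punctured space-time
  domain `Σ` between `∂Σ_δ` (radius `R → 0`, time `T`, co-moving) and `∂Σ_X` (`R_X → ∞`); near-point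
  evaluation `I_δ = −u_k` (40) p. 20, the non-linear divergence `W_k` (§5.1, (37)–(39)) "disappears in the
  limit" by the choice `R_X ∼ 1/R`, `T ∼ R³` (l. 1506–1511); far field `I_X → 0` (42) p. 21). TYPED at the
  grain §8 consumes it: for every solution of the ansatz class on a slab and every Lagrangian path there
  is a kernel (the flow-aligned nslet family, "the right hand side kernal … is also an unknown", l. 818–
  820), linear in the datum, whose truncated integrals over the shells `δ < |x − x′| < δ⁻¹` (the paper's
  `∂Σ_δ`/`∂Σ_X` exhaustion) converge to `−u(x^L, T)`. So typed, Step 1 constrains nothing beyond the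
  existence of SOME representing kernel — the nslet equation (5) with its moving singularity line has no
  finite faithful rendering here (TODO) — and the load is carried by Steps 2–3.
* Step 2 = `Step_2` — §4.1 pp. 9–10 (orders near the origin) with §8 p. 22, l. 1682–1698: "the nslet
  approximates to the eulerlet to order `ε` such that `u_{kj}ΔV′ = u^E_{kj}ΔV′(1 + O(ε))` where
  `ε = νT/L²` … for `L` sufficiently small … `ε = νL²` … choosing the first for `L > L₀` and the second for
  `L < L₀` where `L₀ = T^{1/4}` ensures that the nslet approximates to the eulerlet to order `ε = ν√T`
  throughout the whole range of the volume integration": the representing kernel of Step 1 is within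
  RELATIVE order `C ν√T` of the eulerlet kernel (14) at every point, `C` universal (an order-of-magnitude
  statement about the kernels alone, independent of the solution).
* Step 3 = `Step_3` — THE LOAD-BEARING DISPLAY: (46)–(47) pp. 22–23, l. 1700–1719 = Lemma 2 (2) p. 7:
  "Therefore `u_k(x^L,T) = −∫_V uᵢ(x′,0)u^E_{ki}(x−x′,T)dV′(1 + O(ν√T)) = [u_k(x,0) + (1/4π)∫_V uᵢ(x′,0)
  [1/R],_{ki} dV′](1 + O(ν√T)) = [u_k(x,0) − (1/4π)∫_{S_R} uᵢ(x′,0)[1/R],_k nᵢ ds′](1 + O(ν√T))` … on `S_R`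
  as `R → ∞` then `uᵢ → 0` … leaving (47) `u_k(x^L,T) = u_k(x^L,0)(1 + O(ν√T))`." Typed kernel-free, AS
  PRINTED: componentwise, multiplicative, along every Lagrangian path of every solution of the ansatz
  class on every slab `[t₀, t₀+T]` with `ν√T ≤ ε₀`, with ONE constant (`∃ C ∃ ε₀ ∀ ν ∀ T ∀ solutions`:
  the `O` is the kernel's, Step 2, and `ε = 10⁻³` is chosen once for all on p. 23). The two printed
  inferences producing it from Steps 1–2 — l. 1700 "Therefore" (the volume integral inherits the
  kernel's pointwise relative error) and l. 1704–1716 (the eulerlet volume integral of a divergence-free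
  decaying field returns the initial velocity, distributional bookkeeping as in (15) p. 11 [ER:check]) —
  act on conditionally convergent singular integrals in the co-moving frame and are not typed as separate
  Props; their kernel-free output (47) is typed at full strength. Step 3 alone propagates `sup|u|`.
* Step 4 = `Step_4` — (48)–(49) p. 23, l. 1721–1736: "Similarly `u_{k,j}(x^L,T) = u_{k,j}(x^L,0)(1 +
  O(ν√T))` … the same argument applies for all the other derviatives [sic] meaning that the velocity is
  smooth": every derivative of order `n ≥ 1` along the path grows at most by the factor `1 + Cₙ ν√T`
  (norm form of the printed componentwise display; `Cₙ` allowed to depend on `n` — charitable).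
* Step 5 = `Step_5` — IMPLICIT between (49) and "So the solution is smooth in the region `ν√T ≤ ε`"
  (p. 23, l. 1740–1741): bounds along Lagrangian paths are read as bounds at every point of `ℝ³` at time
  `t₀ + T`, i.e. every point is the endpoint of a Lagrangian path of the slab (the flow map is onto;
  classical for smooth bounded velocities).
* Step 6 = `Step_6` — the ITERATION, p. 23, l. 1742–1746: "Choosing for example `ε = 10⁻³`, then this
  applies to a timestep `T = ν⁻²10⁻⁶`. Repeating for `N = 10⁶ν²t` time steps, a general time `t` is
  reached. So the solution exists and is smooth for a general time `t`": typed as its OUTPUT — every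
  solution of the ansatz class on `[0, T*)` has all velocity derivatives bounded on `[0, T*) × ℝ³`.
  The bookkeeping itself is sound: `step6_of_steps : Step_3 → Step_4 → Step_5 → Step_6` is PROVED below
  (induction over slabs of length `(ε₀/ν)²`; the factor `(1 + Cε₀)^{N+1}` is finite for finite `t`).
* Step 7 = `Step_7` — EXISTENCE / CONTINUATION, the «proof by ansatz» (p. 6, l. 553–560; p. 23,
  l. 1746–1752: "This is a proof by ansatz, so it was originally assumed that the velocity and pressure
  were smooth. The formulation was then obtained and shown to represent a velocity and pressure that are
  smooth for all time as originally assumed, giving proof by ansatz"). The literal sentence assumes what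
  it concludes (`AnsatzLiteral`, a tautology: `ansatzLiteral_holds`); the CHARITABLE content that makes
  the argument an argument is the classical continuation dichotomy in the ansatz class, typed as `Step_7`
  (implicit; no local theory is cited in the paper): every datum launches either a global solution of the
  class or a solution on a maximal `[0, T*)` along which some derivative is unbounded.
* Step 8 = `Step_8` — "with bounded energy" (Theorem 1, p. 5, l. 516): IMPLICIT — no line of the paper
  addresses the energy; classical for `ν > 0` in a decaying smooth class (energy inequality).
* HEADLINE `ClaimedTheorem` (Theorem 1 p. 5).

COMPOSITION: proved as `claim_of_steps : Step_1 → Step_2 → Step_3 → Step_4 → Step_5 → Step_6 → Step_7 →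
Step_8 → ClaimedTheorem` — pure logic: Step 7's dichotomy, the blow-up branch being excluded by Step 6
(itself derived in the kernel from Steps 3–5), the energy by Step 8. Steps 1–2 enter only through the
printed derivation of Step 3 (l. 1700–1716, see Step 3) and are carried as hypotheses in their printed
place. The cell's pre-registered locator candidates (CARD §4, both blind predictions): Lemma 1's
flux/ansatz derivation (Steps 1–2/7) and Lemma 2's one-step bound + iteration (Steps 3/6) — adjudicated
by the refuter/referee, not here. For the refuter: the data/solution classes are invariant under the
Navier–Stokes scaling `u ↦ λu(λ²t, λx)` (`ν` fixed), under which the right-hand side of (47) acquires the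
factor `λ⁻¹` (`ν√T ↦ ν√T/λ`) while Lagrangian paths map to Lagrangian paths.

SCALING RIGIDITY (rev 2, kernel): `step3_rigid : Step_3 → ∀ … IsSolutionOn (Icc t₀ (t₀+T)) ν u p →
IsTrajectoryOn u … X → ∀ k, u (t₀+T) (X (t₀+T)) k = u t₀ (X t₀) k` — the display (47) with ONE constant
forces every velocity component to be CONSTANT along every Lagrangian path of every solution of the ansatz
class on every slab (apply (47) to the dilates `c u(c²t, cx)` — the classes are dilation invariant:
`HasStokesletDecay.dilate`, `IsSolutionOn.dilate` (tree `IsClassicalNSSolutionOn.nsRescale_holds`),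
`IsTrajectoryOn.dilate` — and let `c → ∞`). A kernel refutation of `Step_3` therefore needs exactly one
solution of the class with non-constant velocity along one path; the tree has no existence theorem
exporting stokeslet decay at positive times (recorded for the refuter/referee; nothing is asserted).

WHAT THIS IS NOT: not a claim about NS regularity or blow-up; not a claim about any author beyond the
typed locator.
-/

noncomputable section

open Set Function Filter MeasureTheory
open scoped Topology ENNReal NNReal ContDiff

namespace Literature.Claims.NS.Chadwick2023

open Literature.Analysis.FluidPDE

/-! ### Vocabulary of the paper (pp. 5–7, 10, 20–23) -/

/-- "decays like a stokeslet in the far-field" (Theorem 1, p. 5; the paper's far field is the unsteady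
stokeslet's `u ~ u^S ~ 1/R″³`, §6.2 pp. 20–21, l. 1580–1581), RENDERED with all derivatives:
`(1 + |x|)^{3+n} |Dⁿv(x)| ≤ Kₙ` for every `n` (the `n = 0` clause is the literal sentence;
TODO(general form)). [cite: Chadwick2023, Theorem 1 p.5; §6.2 pp.20–21] -/
def HasStokesletDecay (v : EuclideanSpace ℝ (Fin 3) → EuclideanSpace ℝ (Fin 3)) : Prop :=
  ∀ n : ℕ, ∃ K : ℝ, ∀ x, (1 + ‖x‖) ^ (3 + n) * ‖iteratedFDeriv ℝ n v x‖ ≤ K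

/-- The DATA CLASS of Theorem 1 (p. 5, l. 512–514): "initial condition given for the velocity as a `C^∞`
divergence free vector field that decays like a stokeslet in the far-field".
[cite: Chadwick2023, Theorem 1 p.5] -/
def IsDatum (u₀ : EuclideanSpace ℝ (Fin 3) → EuclideanSpace ℝ (Fin 3)) : Prop :=
  ContDiff ℝ ∞ u₀ ∧ NSWave0.IsDivFree u₀ ∧ HasStokesletDecay u₀

/-- The ANSATZ CLASS on a time set `S` (Lemma 1, p. 6, l. 553–556: "it is assumed that the velocity and
pressure … are `C^∞` smooth"; far-field boundary condition l. 543–544: "over the far-field spherinder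
hypersurface `∂Σ_X` the flow field behaves like a stokeslet"): a classical solution of (4) with `f ≡ 0`
and viscosity `ν` on `ℝ³ × S` (tree `IsClassicalNSSolutionOn`) every time slice of which has stokeslet
decay. [cite: Chadwick2023, Lemma 1 pp.5–6] -/
structure IsSolutionOn (S : Set ℝ) (ν : ℝ)
    (u : ℝ → EuclideanSpace ℝ (Fin 3) → EuclideanSpace ℝ (Fin 3))
    (p : ℝ → EuclideanSpace ℝ (Fin 3) → ℝ) : Prop where
  /-- (4) p. 7 with `f ≡ 0` holds classically on `ℝ³ × S`, `u`, `p` jointly `C^∞`. -/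
  isClassical : IsClassicalNSSolutionOn S ν 0 u p
  /-- the far-field stokeslet behaviour at every time of `S` (l. 543–544). -/
  decay : ∀ t ∈ S, HasStokesletDecay (u t)

/-- "`x^L` is the Lagrangian co-ordinate position moving with the fluid" (Lemma 2 p. 7, l. 588–589;
p. 22, l. 1711–1712): `X` is a Lagrangian path of `u` on the time set `S`, `X′(t) = u(t, X(t))` (one-sided
within `S`; the hypothesis form of the tree's `particleTrajectoryMap`, Majda–Bertozzi (1.13)).
[cite: Chadwick2023, Lemma 2 p.7] -/
def IsTrajectoryOn (u : ℝ → EuclideanSpace ℝ (Fin 3) → EuclideanSpace ℝ (Fin 3)) (S : Set ℝ)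
    (X : ℝ → EuclideanSpace ℝ (Fin 3)) : Prop :=
  ∀ t ∈ S, HasDerivWithinAt X (u t (X t)) S t

/-- The eulerlet velocity kernel off its origin, (14) p. 10 [ER:eulerlet-velocity] for `R > 0` and
`t > t′` (`H = 1`): `u^E_{ki}(y) = −(1/4π)[1/R],_{ki} = −(1/4π)(3 y_k yᵢ/|y|⁵ − δ_{ki}/|y|³)`, as the map
`v ↦ (Σᵢ u^E_{ki}(y) vᵢ)_k`. (Junk value at `y = 0`, never used: the shells below exclude it.)
[cite: Chadwick2023, (14) p.10] -/
def eulerletKernel (y v : EuclideanSpace ℝ (Fin 3)) : EuclideanSpace ℝ (Fin 3) :=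
  -(1 / (4 * Real.pi)) • ((3 * inner ℝ y v / ‖y‖ ^ 5) • y - (1 / ‖y‖ ^ 3) • v)

/-- The punctured integration domain of the paper's exhaustion (§5 p. 14, l. 1098–1109; §6.1 p. 20,
l. 1506–1511: "`∂Σ_δ` has … spherical radius `R` small … we can choose `R_X ∼ 1/R` … as `R → 0`"): the
spherical shell `δ < |x′ − c| < δ⁻¹` about the fluid point `c`. [cite: Chadwick2023, §6.1 p.20] -/
def shell (c : EuclideanSpace ℝ (Fin 3)) (δ : ℝ) : Set (EuclideanSpace ℝ (Fin 3)) :=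
  {y | δ < ‖y - c‖ ∧ ‖y - c‖ < δ⁻¹}

/-- Restriction of the ansatz class to a smaller time set of unique differentiability (plumbing; tree
`IsClassicalNSSolutionOn.mono`). [cite: Chadwick2023, Lemma 1 pp.5–6] -/
theorem IsSolutionOn.mono {S S' : Set ℝ} {ν : ℝ}
    {u : ℝ → EuclideanSpace ℝ (Fin 3) → EuclideanSpace ℝ (Fin 3)} {p : ℝ → EuclideanSpace ℝ (Fin 3) → ℝ}
    (h : IsSolutionOn S ν u p) (hS' : S' ⊆ S) (hU : UniqueDiffOn ℝ S') : IsSolutionOn S' ν u p :=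
  ⟨h.isClassical.mono hS' hU, fun t ht => h.decay t (hS' ht)⟩

/-! ### The claimed theorem (p. 5) -/

/-- **HEADLINE — Theorem 1 (p. 5, l. 506–517), as printed**: for the unforced system (4) on `ℝ³`,
`t ≥ 0`, viscosity `ν > 0`, every `C^∞` divergence-free datum with stokeslet far-field decay launches a
velocity and pressure that "exist and are smooth at all subsequent time with bounded energy" — rendered:
a solution of the ansatz class on `ℝ³ × [0,∞)` (the abstract: "A smooth solution with a stokeslet
far-field decay for all subsequent time is sought and found") with `u(0) = u₀` and bounded energy (7).
[claim: Chadwick2023, status: disputed] -/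
def ClaimedTheorem : Prop :=
  ∀ ν : ℝ, 0 < ν → ∀ u₀ : EuclideanSpace ℝ (Fin 3) → EuclideanSpace ℝ (Fin 3), IsDatum u₀ →
    ∃ (u : ℝ → EuclideanSpace ℝ (Fin 3) → EuclideanSpace ℝ (Fin 3)) (p : ℝ → EuclideanSpace ℝ (Fin 3) → ℝ),
      IsSolutionOn (Ici 0) ν u p ∧ u 0 = u₀ ∧ HasBoundedEnergy u

/-! ### The paper's steps (no assertion) -/

/-- **Step 1 — Lemma 1: the nslet representation (1) p. 6 = (44)–(45) pp. 21–22 [MP:IVP,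
MP:IVPwithfunvar], "Proof. Given in Sections 3-7"**: "the Green's integral representation for the velocity
`u_k(x,t)` is given by a boundary integral distribution of nslet fundamental solutions with strength given
by (minus) the initial velocity, distributed over the all of space volume `V` at the initial time `t = 0`
so `u_k(x,t) = −∫_V uᵢ(x′,0) u_{ki}(x−x′,t) dV′`, where `u_{ki}` is the `i`th velocity component of the
`k`th nslet and is chosen to be aligned to the fluid direction at its origin" (evaluated in §8 at the
Lagrangian point `x^L`, (46)). TYPED at the grain §8 consumes it, over the ansatz class on a slab
`[t₀, t₀+T]` (datum = the slice at `t₀`; "timestep", p. 23): along every Lagrangian path `X` there is a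
kernel `𝒦` (`𝒦 x′ v = (Σᵢ u_{ki}(x^L − x′, T) vᵢ)_k`, the flow-aligned nslet family — solution-dependent,
"the right hand side kernal (fundamental solution) is also an unknown", l. 818–820), linear in `v`, whose
truncated integrals over the shells of the paper's exhaustion (`∂Σ_δ`, `∂Σ_X`, §§5–6) converge:
`∫_{δ<|x′−x|<δ⁻¹} 𝒦(x′) u(t₀,x′) dx′ → −u(t₀+T, X(t₀+T))` as `δ → 0⁺`, `x = X(t₀)`. The nslet equation (5)
p. 8 itself (full Navier–Stokes with a space-time point force and a singularity line moving with the
fluid) is NOT rendered (TODO): so typed, the step only asserts that a representing kernel exists.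
[claim: Chadwick2023, status: disputed] -/
def Step_1 : Prop :=
  ∀ ν : ℝ, 0 < ν → ∀ t₀ T : ℝ, 0 ≤ t₀ → 0 < T →
    ∀ (u : ℝ → EuclideanSpace ℝ (Fin 3) → EuclideanSpace ℝ (Fin 3)) (p : ℝ → EuclideanSpace ℝ (Fin 3) → ℝ),
      IsSolutionOn (Icc t₀ (t₀ + T)) ν u p →
      ∀ X : ℝ → EuclideanSpace ℝ (Fin 3), IsTrajectoryOn u (Icc t₀ (t₀ + T)) X →
        ∃ 𝒦 : EuclideanSpace ℝ (Fin 3) → EuclideanSpace ℝ (Fin 3) → EuclideanSpace ℝ (Fin 3),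
          (∀ x', IsLinearMap ℝ (𝒦 x')) ∧
          Tendsto (fun δ : ℝ => ∫ x' in shell (X t₀) δ, 𝒦 x' (u t₀ x')) (𝓝[>] 0)
            (𝓝 (-(u (t₀ + T) (X (t₀ + T)))))

/-- **Step 2 — the nslet is the eulerlet to relative order `ε = ν√T` "throughout the whole range of the
volume integration" (§8 p. 22, l. 1682–1698, with the orders of §4.1 pp. 9–10)**: "the nslet approximates
to the eulerlet to order `ε` such that `u_{kj}ΔV′ = u^E_{kj}ΔV′(1 + O(ε))` where `ε = νL⁻⁵/(L⁻³T⁻¹) =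
νT/L²` … for `L` sufficiently small … `ε = νL⁻⁵/L⁻⁷ = νL²` … Making use of both bounds by choosing the
first for `L > L₀` and the second for `L < L₀` where `L₀ = T^{1/4}` ensures that the nslet approximates
to the eulerlet to order `ε = ν√T` throughout the whole range of the volume integration." TYPED: with ONE
constant `C` (a statement about the kernels, independent of the solution), the representing kernel of
Step 1 is pointwise within relative error `C ν√T` of the eulerlet kernel (14) centred at the fluid point:
`|𝒦(x′)v − u^E(x − x′)v| ≤ C ν√T |u^E(x − x′)v|` for all `x′ ≠ x = X(t₀)` and all `v`. (Contains Step 1: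
`step1_of_step2`.) [claim: Chadwick2023, status: disputed] -/
def Step_2 : Prop :=
  ∃ C : ℝ, 0 ≤ C ∧ ∀ ν : ℝ, 0 < ν → ∀ t₀ T : ℝ, 0 ≤ t₀ → 0 < T →
    ∀ (u : ℝ → EuclideanSpace ℝ (Fin 3) → EuclideanSpace ℝ (Fin 3)) (p : ℝ → EuclideanSpace ℝ (Fin 3) → ℝ),
      IsSolutionOn (Icc t₀ (t₀ + T)) ν u p →
      ∀ X : ℝ → EuclideanSpace ℝ (Fin 3), IsTrajectoryOn u (Icc t₀ (t₀ + T)) X →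
        ∃ 𝒦 : EuclideanSpace ℝ (Fin 3) → EuclideanSpace ℝ (Fin 3) → EuclideanSpace ℝ (Fin 3),
          (∀ x', IsLinearMap ℝ (𝒦 x')) ∧
          Tendsto (fun δ : ℝ => ∫ x' in shell (X t₀) δ, 𝒦 x' (u t₀ x')) (𝓝[>] 0)
            (𝓝 (-(u (t₀ + T) (X (t₀ + T))))) ∧
          ∀ x', x' ≠ X t₀ → ∀ v,
            ‖𝒦 x' v - eulerletKernel (X t₀ - x') v‖ ≤
              C * (ν * Real.sqrt T) * ‖eulerletKernel (X t₀ - x') v‖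

/-- **Step 3 — THE LOAD-BEARING DISPLAY (46)–(47) pp. 22–23 (l. 1700–1719) = Lemma 2, (2) p. 7**:
"Therefore `u_k(x^L,T) = −∫_V uᵢ(x′,0) u^E_{ki}(x−x′,T) dV′ (1 + O(ν√T)) = [u_k(x,0) + (1/4π)∫_V uᵢ(x′,0)
[1/R],_{ki} dV′](1 + O(ν√T)) = [u_k(x,0) − (1/4π)∫_{S_R} uᵢ(x′,0)[1/R],_k nᵢ ds′](1 + O(ν√T))` since
`uᵢ[1/R],_{ki} = −[uᵢ[1/R],_k],_{i′}` … However, on `S_R` as `R → ∞` then `uᵢ → 0`, `S_R = O(R²)`,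
`[1/R],_k = O(R⁻²)` and so the integral decays to zero in the limit leaving (47)
`u_k(x^L,T) = u_k(x^L,0)(1 + O(ν√T))`." TYPED AS PRINTED, kernel-free: there are ONE constant `C` and
ONE smallness threshold `ε₀` ("Consider `T` sufficiently small", l. 1682; "the region `ν√T ≤ ε` for
small `ε`. Choosing for example `ε = 10⁻³`", l. 1740–1742; the `O` is the kernel's of Step 2) such that
for every viscosity, every slab `[t₀, t₀+T]` with `ν√T ≤ ε₀`, every solution of the ansatz class on the
slab and every Lagrangian path `X` of it, COMPONENTWISE
`|u_k(t₀+T, X(t₀+T)) − u_k(t₀, X(t₀))| ≤ C ν√T |u_k(t₀, X(t₀))|`, `k = 1, 2, 3`.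
[claim: Chadwick2023, status: disputed] -/
def Step_3 : Prop :=
  ∃ C : ℝ, 0 ≤ C ∧ ∃ ε₀ : ℝ, 0 < ε₀ ∧ ∀ ν : ℝ, 0 < ν → ∀ t₀ T : ℝ, 0 ≤ t₀ → 0 < T →
    ν * Real.sqrt T ≤ ε₀ →
    ∀ (u : ℝ → EuclideanSpace ℝ (Fin 3) → EuclideanSpace ℝ (Fin 3)) (p : ℝ → EuclideanSpace ℝ (Fin 3) → ℝ),
      IsSolutionOn (Icc t₀ (t₀ + T)) ν u p →
      ∀ X : ℝ → EuclideanSpace ℝ (Fin 3), IsTrajectoryOn u (Icc t₀ (t₀ + T)) X →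
        ∀ k : Fin 3,
          |u (t₀ + T) (X (t₀ + T)) k - u t₀ (X t₀) k| ≤ C * (ν * Real.sqrt T) * |u t₀ (X t₀) k|

/-- **Step 4 — (48)–(49) p. 23 (l. 1721–1736), all derivatives**: "Similarly, `u_{k,j}(x^L,T) =
u_{k,j}(x,0)(1 + O(ν√T)) − (1/4π)∫_{S_R} uᵢ(x′,0)[1/R],_{kj} nᵢ ds′ (1 + O(ν√T))` such that on `S_R`,
`[1/R],_{kj} = O(R⁻³)` and so the integral decays even faster to zero giving (49) `u_{k,j}(x^L,T) =
u_{k,j}(x^L,0)(1 + O(ν√T))`. Similarly, the same argument applies for all the other derviatives [sic]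
meaning that the velocity is smooth." TYPED (norm form of the printed componentwise display, one constant
`Cₙ ≥ 0` per derivative order `n ≥ 1` — charitable — and one threshold `ε₀`): along every Lagrangian path
of every solution of the ansatz class on a slab with `ν√T ≤ ε₀`,
`‖Dⁿu(t₀+T)(X(t₀+T))‖ ≤ (1 + Cₙ ν√T) ‖Dⁿu(t₀)(X(t₀))‖`. [claim: Chadwick2023, status: disputed] -/
def Step_4 : Prop :=
  ∃ C : ℕ → ℝ, (∀ n, 0 ≤ C n) ∧ ∃ ε₀ : ℝ, 0 < ε₀ ∧ ∀ ν : ℝ, 0 < ν → ∀ t₀ T : ℝ, 0 ≤ t₀ → 0 < T →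
    ν * Real.sqrt T ≤ ε₀ →
    ∀ (u : ℝ → EuclideanSpace ℝ (Fin 3) → EuclideanSpace ℝ (Fin 3)) (p : ℝ → EuclideanSpace ℝ (Fin 3) → ℝ),
      IsSolutionOn (Icc t₀ (t₀ + T)) ν u p →
      ∀ X : ℝ → EuclideanSpace ℝ (Fin 3), IsTrajectoryOn u (Icc t₀ (t₀ + T)) X →
        ∀ n : ℕ, 1 ≤ n →
          ‖iteratedFDeriv ℝ n (u (t₀ + T)) (X (t₀ + T))‖ ≤
            (1 + C n * (ν * Real.sqrt T)) * ‖iteratedFDeriv ℝ n (u t₀) (X t₀)‖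

/-- **Step 5 — IMPLICIT between (49) and "So the solution is smooth in the region `ν√T ≤ ε`" (p. 23,
l. 1740–1741)**: the bounds (47)/(49) hold at Lagrangian points `x^L`; reading them as bounds on the
velocity and its derivatives EVERYWHERE at time `t₀ + T` uses that every point of `ℝ³` is the position at
time `t₀ + T` of a fluid particle of the slab — the flow map of the slab is onto. TYPED: for every
solution of the ansatz class on `[t₀, t₀+T]` and every `y` there is a Lagrangian path `X` on the slab with
`X(t₀+T) = y`. (Classical for smooth bounded velocity fields: backward integration of `X′ = u(t,X)`.)
[claim: Chadwick2023, status: disputed] -/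
def Step_5 : Prop :=
  ∀ ν : ℝ, 0 < ν → ∀ t₀ T : ℝ, 0 ≤ t₀ → 0 < T →
    ∀ (u : ℝ → EuclideanSpace ℝ (Fin 3) → EuclideanSpace ℝ (Fin 3)) (p : ℝ → EuclideanSpace ℝ (Fin 3) → ℝ),
      IsSolutionOn (Icc t₀ (t₀ + T)) ν u p →
      ∀ y : EuclideanSpace ℝ (Fin 3), ∃ X : ℝ → EuclideanSpace ℝ (Fin 3),
        IsTrajectoryOn u (Icc t₀ (t₀ + T)) X ∧ X (t₀ + T) = y

/-- **Step 6 — the ITERATION (p. 23, l. 1740–1746)**: "So the solution is smooth in the region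
`ν√T ≤ ε` for small `ε`. Choosing for example `ε = 10⁻³`, then this applies to a timestep `T = ν⁻²10⁻⁶`.
Repeating for `N = 10⁶ν²t` time steps, a general time `t` is reached. So the solution exists and is
smooth for a general time `t`." TYPED as the OUTPUT of the iteration (the a priori bound it delivers):
every solution of the ansatz class on `[0, T*)`, `T* > 0`, has every velocity derivative bounded on
`[0, T*) × ℝ³` (by `(1 + Cε)^{N+1} sup|Dⁿu(0)|`, `N = ⌈ν²T*/ε²⌉`; only boundedness is typed). The
bookkeeping is sound GIVEN uniform one-step bounds: `step6_of_steps` derives this step from Steps 3–5.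
[claim: Chadwick2023, status: disputed] -/
def Step_6 : Prop :=
  ∀ ν : ℝ, 0 < ν → ∀ T : ℝ, 0 < T →
    ∀ (u : ℝ → EuclideanSpace ℝ (Fin 3) → EuclideanSpace ℝ (Fin 3)) (p : ℝ → EuclideanSpace ℝ (Fin 3) → ℝ),
      IsSolutionOn (Ico 0 T) ν u p →
      ∀ n : ℕ, ∃ B : ℝ, ∀ t ∈ Ico 0 T, ∀ y, ‖iteratedFDeriv ℝ n (u t) y‖ ≤ B

/-- **Step 7 — EXISTENCE / CONTINUATION: the «proof by ansatz» (p. 6, l. 553–560; p. 23, l. 1746–1752)**,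
CHARITABLE RENDERING (implicit; the paper cites no local theory): the classical continuation dichotomy in
the ansatz class — for every `ν > 0` and every datum, EITHER there is a solution of the class on
`ℝ³ × [0,∞)` with `u(0) = u₀`, OR there are a finite `T* > 0` and a solution of the class on `[0, T*)`
with `u(0) = u₀` along which some velocity derivative is unbounded on `[0, T*) × ℝ³` (a maximal solution
that cannot be smoothly continued). The LITERAL sentence ("it was originally assumed that the velocity and
pressure were smooth … shown to represent a velocity and pressure that are smooth for all time as
originally assumed") is the tautology `AnsatzLiteral` below. [claim: Chadwick2023, status: disputed] -/
def Step_7 : Prop :=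
  ∀ ν : ℝ, 0 < ν → ∀ u₀ : EuclideanSpace ℝ (Fin 3) → EuclideanSpace ℝ (Fin 3), IsDatum u₀ →
    (∃ (u : ℝ → EuclideanSpace ℝ (Fin 3) → EuclideanSpace ℝ (Fin 3)) (p : ℝ → EuclideanSpace ℝ (Fin 3) → ℝ),
      IsSolutionOn (Ici 0) ν u p ∧ u 0 = u₀) ∨
    ∃ T : ℝ, 0 < T ∧
      ∃ (u : ℝ → EuclideanSpace ℝ (Fin 3) → EuclideanSpace ℝ (Fin 3)) (p : ℝ → EuclideanSpace ℝ (Fin 3) → ℝ),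
        IsSolutionOn (Ico 0 T) ν u p ∧ u 0 = u₀ ∧
          ∃ n : ℕ, ∀ B : ℝ, ∃ t ∈ Ico 0 T, ∃ y, B < ‖iteratedFDeriv ℝ n (u t) y‖

/-- The LITERAL «proof by ansatz» sentence (p. 6, l. 553–560 with p. 23, l. 1748–1752): ASSUMING the
velocity and pressure are `C^∞` for all time (a global solution of the ansatz class from `u₀` exists),
the formulation "represent[s] a velocity and pressure that are smooth for all time as originally
assumed" (such a solution exists). Typed verbatim it is `H → H`; see `ansatzLiteral_holds`. Recorded so
that the referee can choose between the literal and the charitable (`Step_7`) readings; NOT consumed by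
`claim_of_steps`. [claim: Chadwick2023, status: disputed] -/
def AnsatzLiteral : Prop :=
  ∀ ν : ℝ, 0 < ν → ∀ u₀ : EuclideanSpace ℝ (Fin 3) → EuclideanSpace ℝ (Fin 3), IsDatum u₀ →
    (∃ (u : ℝ → EuclideanSpace ℝ (Fin 3) → EuclideanSpace ℝ (Fin 3)) (p : ℝ → EuclideanSpace ℝ (Fin 3) → ℝ),
      IsSolutionOn (Ici 0) ν u p ∧ u 0 = u₀) →
    ∃ (u : ℝ → EuclideanSpace ℝ (Fin 3) → EuclideanSpace ℝ (Fin 3)) (p : ℝ → EuclideanSpace ℝ (Fin 3) → ℝ),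
      IsSolutionOn (Ici 0) ν u p ∧ u 0 = u₀

/-- **Step 8 — "with bounded energy" (Theorem 1, p. 5, l. 515–516)**: IMPLICIT — no line of the proof
addresses the energy. TYPED: every solution of the ansatz class on `ℝ³ × [0,∞)` (`ν > 0`) has bounded
energy (7), `∫|u(t)|² ≤ C < ∞` for all `t ≥ 0`. (Classical: energy inequality for smooth solutions
decaying like `|x|⁻³` with decaying gradient — no boundary flux at infinity.)
[claim: Chadwick2023, status: disputed] -/
def Step_8 : Prop :=
  ∀ ν : ℝ, 0 < ν →
    ∀ (u : ℝ → EuclideanSpace ℝ (Fin 3) → EuclideanSpace ℝ (Fin 3)) (p : ℝ → EuclideanSpace ℝ (Fin 3) → ℝ),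
      IsSolutionOn (Ici 0) ν u p → HasBoundedEnergy u

/-! ### Kernel relations -/

/-- Step 2 contains Step 1 (the representation is its first two clauses).
[cite: Chadwick2023, Lemma 1 p.6 and §8 p.22] -/
theorem step1_of_step2 (h : Step_2) : Step_1 := by
  obtain ⟨C, -, h⟩ := h
  intro ν hν t₀ T ht₀ hT u p hsol X hX
  obtain ⟨𝒦, hlin, hrep, -⟩ := h ν hν t₀ T ht₀ hT u p hsol X hX
  exact ⟨𝒦, hlin, hrep⟩

/-- The literal «proof by ansatz» sentence is a tautology (it assumes what it concludes).
[cite: Chadwick2023, Lemma 1 p.6 (l.553–560) and §8 p.23 (l.1748–1752)] -/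
theorem ansatzLiteral_holds : AnsatzLiteral :=
  fun _ _ _ _ h => h

/-- In the data class every derivative of the datum is bounded (`(1+|x|)^{3+n} ≥ 1`). Plumbing for the
iteration. [cite: Chadwick2023, Theorem 1 p.5] -/
theorem HasStokesletDecay.exists_bound {v : EuclideanSpace ℝ (Fin 3) → EuclideanSpace ℝ (Fin 3)}
    (h : HasStokesletDecay v) (n : ℕ) : ∃ M : ℝ, 0 ≤ M ∧ ∀ x, ‖iteratedFDeriv ℝ n v x‖ ≤ M := by
  obtain ⟨K, hK⟩ := h n
  refine ⟨max K 0, le_max_right _ _, fun x => ?_⟩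
  have h1 : (1 : ℝ) ≤ (1 + ‖x‖) ^ (3 + n) := one_le_pow₀ (by linarith [norm_nonneg x])
  have h2 : ‖iteratedFDeriv ℝ n v x‖ ≤ (1 + ‖x‖) ^ (3 + n) * ‖iteratedFDeriv ℝ n v x‖ :=
    le_mul_of_one_le_left (norm_nonneg _) h1
  exact (h2.trans (hK x)).trans (le_max_left _ _)

/-- From the printed componentwise bound (47) to the bound on the Euclidean norm:
`|a_k − b_k| ≤ c|b_k|` for `k = 1,2,3` with `c ≥ 0` gives `‖a‖ ≤ (1 + c)‖b‖`. Plumbing.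
[cite: Chadwick2023, (47) p.23] -/
theorem norm_le_of_componentwise {a b : EuclideanSpace ℝ (Fin 3)} {c : ℝ} (hc : 0 ≤ c)
    (h : ∀ k : Fin 3, |a k - b k| ≤ c * |b k|) : ‖a‖ ≤ (1 + c) * ‖b‖ := by
  have hk : ∀ k : Fin 3, |a k| ≤ (1 + c) * |b k| := by
    intro k
    have := h k
    have hab : |a k| ≤ |a k - b k| + |b k| := by
      have := abs_add_le (a k - b k) (b k)
      simpa using this
    nlinarith [abs_nonneg (b k)]
  have h1c : 0 ≤ 1 + c := by linarith
  rw [EuclideanSpace.norm_eq a, EuclideanSpace.norm_eq b]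
  have hsum : ∑ k : Fin 3, ‖a k‖ ^ 2 ≤ ∑ k : Fin 3, ((1 + c) * ‖b k‖) ^ 2 := by
    refine Finset.sum_le_sum fun k _ => ?_
    have h0 : 0 ≤ ‖a k‖ := norm_nonneg _
    have hk' : ‖a k‖ ≤ (1 + c) * ‖b k‖ := by simpa [Real.norm_eq_abs] using hk k
    exact pow_le_pow_left₀ h0 hk' 2
  have hfac : ∑ k : Fin 3, ((1 + c) * ‖b k‖) ^ 2 = (1 + c) ^ 2 * ∑ k : Fin 3, ‖b k‖ ^ 2 := by
    rw [Finset.mul_sum]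
    refine Finset.sum_congr rfl fun k _ => ?_
    ring
  calc Real.sqrt (∑ k : Fin 3, ‖a k‖ ^ 2)
      ≤ Real.sqrt ((1 + c) ^ 2 * ∑ k : Fin 3, ‖b k‖ ^ 2) := Real.sqrt_le_sqrt (hfac ▸ hsum)
    _ = (1 + c) * Real.sqrt (∑ k : Fin 3, ‖b k‖ ^ 2) := by
        rw [Real.sqrt_mul (sq_nonneg _), Real.sqrt_sq h1c]

/-- **One time step, sup-norm form (p. 23, l. 1740–1741 "So the solution is smooth in the region
`ν√T ≤ ε`")**: Steps 3–5 give, for every derivative order `n`, constants `c ≥ 0`, `ε > 0` such that on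
every slab `[t₀, t₀+τ]` with `ν√τ ≤ ε` a bound `sup|Dⁿu(t₀)| ≤ M` propagates to
`sup|Dⁿu(t₀+τ)| ≤ (1 + c ν√τ) M`. Pure logic from the three steps (plus `norm_le_of_componentwise` for
`n = 0`). [cite: Chadwick2023, §8 p.23 (l.1740–1741)] -/
theorem oneStep_of_steps (h3 : Step_3) (h4 : Step_4) (h5 : Step_5) (n : ℕ) :
    ∃ c : ℝ, 0 ≤ c ∧ ∃ ε : ℝ, 0 < ε ∧ ∀ ν : ℝ, 0 < ν → ∀ t₀ τ : ℝ, 0 ≤ t₀ → 0 < τ →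
      ν * Real.sqrt τ ≤ ε →
      ∀ (u : ℝ → EuclideanSpace ℝ (Fin 3) → EuclideanSpace ℝ (Fin 3))
        (p : ℝ → EuclideanSpace ℝ (Fin 3) → ℝ), IsSolutionOn (Icc t₀ (t₀ + τ)) ν u p →
        ∀ M : ℝ, (∀ y, ‖iteratedFDeriv ℝ n (u t₀) y‖ ≤ M) →
          ∀ y, ‖iteratedFDeriv ℝ n (u (t₀ + τ)) y‖ ≤ (1 + c * (ν * Real.sqrt τ)) * M := by
  obtain ⟨C₃, hC₃, ε₃, hε₃, h3⟩ := h3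
  obtain ⟨C₄, hC₄, ε₄, hε₄, h4⟩ := h4
  rcases Nat.eq_zero_or_pos n with rfl | hn
  · -- order zero: the printed display (47), componentwise, then the norm
    refine ⟨C₃, hC₃, ε₃, hε₃, fun ν hν t₀ τ ht₀ hτ hε u p hsol M hM y => ?_⟩
    obtain ⟨X, hX, hXy⟩ := h5 ν hν t₀ τ ht₀ hτ u p hsol y
    have hcomp := h3 ν hν t₀ τ ht₀ hτ hε u p hsol X hX
    have hnorm : ‖u (t₀ + τ) (X (t₀ + τ))‖ ≤ (1 + C₃ * (ν * Real.sqrt τ)) * ‖u t₀ (X t₀)‖ :=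
      norm_le_of_componentwise (mul_nonneg hC₃ (mul_nonneg hν.le (Real.sqrt_nonneg _))) hcomp
    have hM0 : ‖u t₀ (X t₀)‖ ≤ M := by simpa [norm_iteratedFDeriv_zero] using hM (X t₀)
    have hfac : 0 ≤ 1 + C₃ * (ν * Real.sqrt τ) := by
      have := mul_nonneg hC₃ (mul_nonneg hν.le (Real.sqrt_nonneg τ)); linarith
    rw [norm_iteratedFDeriv_zero, ← hXy]
    exact hnorm.trans (mul_le_mul_of_nonneg_left hM0 hfac)
  · -- order `n ≥ 1`: (49) and "all the other derivatives"
    refine ⟨C₄ n, hC₄ n, ε₄, hε₄, fun ν hν t₀ τ ht₀ hτ hε u p hsol M hM y => ?_⟩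
    obtain ⟨X, hX, hXy⟩ := h5 ν hν t₀ τ ht₀ hτ u p hsol y
    have hder := h4 ν hν t₀ τ ht₀ hτ hε u p hsol X hX n hn
    have hfac : 0 ≤ 1 + C₄ n * (ν * Real.sqrt τ) := by
      have := mul_nonneg (hC₄ n) (mul_nonneg hν.le (Real.sqrt_nonneg τ)); linarith
    rw [← hXy]
    exact hder.trans (mul_le_mul_of_nonneg_left (hM (X t₀)) hfac)

/-- **The iteration is sound bookkeeping (p. 23, l. 1742–1746: "Choosing for example `ε = 10⁻³`, then this
applies to a timestep `T = ν⁻²10⁻⁶`. Repeating for `N = 10⁶ν²t` time steps, a general time `t` is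
reached")**: GIVEN the uniform one-step bounds of Steps 3–4 and the onto-ness of Step 5, every solution of
the ansatz class on `[0, T*)` has all velocity derivatives bounded on `[0, T*) × ℝ³` — by induction over
slabs of length `τ₀ = (ε/ν)²`, with the bound `(1 + cε)^j sup|Dⁿu(0)|` after `j` slabs. So the kernel
composition consumes Step 6 only through Steps 3–5. [cite: Chadwick2023, §8 p.23 (l.1742–1746)] -/
theorem step6_of_steps (h3 : Step_3) (h4 : Step_4) (h5 : Step_5) : Step_6 := by
  intro ν hν T hT u p hsol n
  obtain ⟨c, hc, ε, hε, hstep⟩ := oneStep_of_steps h3 h4 h5 n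
  -- the initial bound from the stokeslet decay of the slice `u 0`
  obtain ⟨M₀, hM₀, hinit⟩ := (hsol.decay 0 ⟨le_rfl, hT⟩).exists_bound n
  -- the step length `τ₀ = (ε/ν)²`, so that `ν √τ₀ = ε`
  set τ₀ : ℝ := (ε / ν) ^ 2 with hτ₀
  have hεν : 0 < ε / ν := div_pos hε hν
  have hτ₀pos : 0 < τ₀ := by rw [hτ₀]; positivity
  have hsqrt : Real.sqrt τ₀ = ε / ν := by rw [hτ₀, Real.sqrt_sq hεν.le]
  have hντ₀ : ν * Real.sqrt τ₀ = ε := by rw [hsqrt]; field_simp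
  -- the one-step factor
  set q : ℝ := 1 + c * ε with hq
  have hq1 : 1 ≤ q := by rw [hq]; nlinarith
  have hq0 : 0 ≤ q := by linarith
  -- one step of any admissible length `τ ≤ τ₀` inside `[0, T)`
  have step : ∀ t₀ τ : ℝ, 0 ≤ t₀ → 0 < τ → τ ≤ τ₀ → t₀ + τ < T →
      ∀ M : ℝ, 0 ≤ M → (∀ y, ‖iteratedFDeriv ℝ n (u t₀) y‖ ≤ M) →
        ∀ y, ‖iteratedFDeriv ℝ n (u (t₀ + τ)) y‖ ≤ q * M := by
    intro t₀ τ ht₀ hτ hττ₀ htT M hM hbound y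
    have hsub : Icc t₀ (t₀ + τ) ⊆ Ico 0 T := fun s hs => ⟨ht₀.trans hs.1, lt_of_le_of_lt hs.2 htT⟩
    have hsol' : IsSolutionOn (Icc t₀ (t₀ + τ)) ν u p :=
      hsol.mono hsub (uniqueDiffOn_Icc (by linarith))
    have hντ : ν * Real.sqrt τ ≤ ε := by
      rw [← hντ₀]
      exact mul_le_mul_of_nonneg_left (Real.sqrt_le_sqrt hττ₀) hν.le
    have h1 := hstep ν hν t₀ τ ht₀ hτ hντ u p hsol' M hbound y
    have hfac : 1 + c * (ν * Real.sqrt τ) ≤ q := by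
      rw [hq]; linarith [mul_le_mul_of_nonneg_left hντ hc]
    exact h1.trans (mul_le_mul_of_nonneg_right hfac hM)
  -- induction over the number of slabs
  have iter : ∀ j : ℕ, ∀ t ∈ Ico 0 T, t ≤ j * τ₀ →
      ∀ y, ‖iteratedFDeriv ℝ n (u t) y‖ ≤ q ^ j * M₀ := by
    intro j
    induction j with
    | zero =>
      intro t ht htj y
      have ht0 : t = 0 := le_antisymm (by simpa using htj) ht.1
      subst ht0
      simpa using hinit y
    | succ j ih =>
      intro t ht htj y
      rcases le_or_gt t (j * τ₀) with hsmall | hsmall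
      · have := ih t ht hsmall y
        have hmono : q ^ j * M₀ ≤ q ^ (j + 1) * M₀ :=
          mul_le_mul_of_nonneg_right (pow_le_pow_right₀ hq1 (Nat.le_succ j)) hM₀
        exact this.trans hmono
      · rcases le_or_gt t τ₀ with hfirst | hfirst
        · -- a single step from time `0` of length `t > 0`
          have htpos : 0 < t := by
            have : (0:ℝ) ≤ j * τ₀ := mul_nonneg (Nat.cast_nonneg j) hτ₀pos.le
            linarith
          have h1 := step 0 t le_rfl htpos hfirst (by simpa using ht.2) M₀ hM₀
            (fun y => hinit y) y
          rw [zero_add] at h1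
          have hmono : q * M₀ ≤ q ^ (j + 1) * M₀ := by
            refine mul_le_mul_of_nonneg_right ?_ hM₀
            calc q = q ^ 1 := (pow_one q).symm
              _ ≤ q ^ (j + 1) := pow_le_pow_right₀ hq1 (by omega)
          exact h1.trans hmono
        · -- a full step of length `τ₀` from time `t - τ₀`, where the induction hypothesis applies
          have ht₀' : 0 ≤ t - τ₀ := by linarith
          have hmem : t - τ₀ ∈ Ico 0 T := ⟨ht₀', by linarith [ht.2]⟩
          have hle : t - τ₀ ≤ j * τ₀ := by
            have : ((j + 1 : ℕ) : ℝ) * τ₀ = j * τ₀ + τ₀ := by push_cast; ring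
            linarith [this ▸ htj]
          have hprev : ∀ y, ‖iteratedFDeriv ℝ n (u (t - τ₀)) y‖ ≤ q ^ j * M₀ :=
            fun y => ih (t - τ₀) hmem hle y
          have hMj : 0 ≤ q ^ j * M₀ := mul_nonneg (pow_nonneg hq0 j) hM₀
          have h1 := step (t - τ₀) τ₀ ht₀' hτ₀pos le_rfl (by simpa using ht.2) (q ^ j * M₀) hMj
            hprev y
          have heq : t - τ₀ + τ₀ = t := by ring
          rw [heq] at h1
          calc ‖iteratedFDeriv ℝ n (u t) y‖ ≤ q * (q ^ j * M₀) := h1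
            _ = q ^ (j + 1) * M₀ := by ring
  -- every `t < T` lies below `N τ₀` for `N = ⌈T/τ₀⌉`
  refine ⟨q ^ ⌈T / τ₀⌉₊ * M₀, fun t ht y => iter ⌈T / τ₀⌉₊ t ht ?_ y⟩
  have h1 : T / τ₀ ≤ (⌈T / τ₀⌉₊ : ℝ) := Nat.le_ceil _
  have h2 : T ≤ (⌈T / τ₀⌉₊ : ℝ) * τ₀ := by
    have := mul_le_mul_of_nonneg_right h1 hτ₀pos.le
    rwa [div_mul_cancel₀ T hτ₀pos.ne'] at this
  exact ht.2.le.trans h2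

/-! ### Composition and the Clay link -/

/-- **Composition — Steps 1–8 in the printed order give Theorem 1.** For `ν > 0` and a datum, Step 7
gives a global solution of the ansatz class — whose energy Step 8 bounds — or a solution on a maximal
`[0, T*)` along which some derivative is unbounded; the latter contradicts the a priori bound of Step 6
(the iteration of the one-step bounds (47)/(49), itself derived from Steps 3–5 in `step6_of_steps`).
Steps 1–2 are the printed premises of Step 3 (l. 1700–1716) and are carried in their place. Pure logic;
nothing is asserted. [claim: Chadwick2023, status: disputed] -/
theorem claim_of_steps (_h1 : Step_1) (_h2 : Step_2) (_h3 : Step_3) (_h4 : Step_4) (_h5 : Step_5)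
    (h6 : Step_6) (h7 : Step_7) (h8 : Step_8) : ClaimedTheorem := by
  intro ν hν u₀ hu₀
  rcases h7 ν hν u₀ hu₀ with ⟨u, p, hsol, h0⟩ | ⟨T, hT, u, p, hsol, -, n, hunb⟩
  · exact ⟨u, p, hsol, h0, h8 ν hν u p hsol⟩
  · exfalso
    obtain ⟨B, hB⟩ := h6 ν hν T hT u p hsol n
    obtain ⟨t, ht, y, hy⟩ := hunb B
    exact lt_irrefl B (hy.trans_le (hB t ht y))

/-- The same composition with Step 6 DERIVED from Steps 3–5 (`step6_of_steps`): Theorem 1 follows from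
Steps 3, 4, 5, 7, 8 alone. [claim: Chadwick2023, status: disputed] -/
theorem claim_of_steps' (h1 : Step_1) (h2 : Step_2) (h3 : Step_3) (h4 : Step_4) (h5 : Step_5)
    (h7 : Step_7) (h8 : Step_8) : ClaimedTheorem :=
  claim_of_steps h1 h2 h3 h4 h5 (step6_of_steps h3 h4 h5) h7 h8

/-- Every Clay datum (smooth, divergence free, rapid decay (4)) is a datum of Theorem 1 (Δ4: the class is
wider than Clay's). [cite: FeffermanClay2006, statement (A) with (4), CMI offprint p. 2] -/
theorem isDatum_of_clay {u₀ : EuclideanSpace ℝ (Fin 3) → EuclideanSpace ℝ (Fin 3)} (hu₀ : ContDiff ℝ ∞ u₀)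
    (hdiv : NSWave0.IsDivFree u₀) (hdec : HasRapidSpatialDecay u₀) : IsDatum u₀ :=
  ⟨hu₀, hdiv, fun n => hdec n (3 + n)⟩

/-- **Clay link: Theorem 1 implies Clay (A)** (`ClayVariants.clayR3.Regularity`, token-for-token the
summit body): a Clay datum is a datum (`isDatum_of_clay`); the global solution of the ansatz class is
smooth on `ℝ³ × [0,∞)` with `u(0) = u₀` (bridge `isNavierStokesSolution_and_smooth_iff`) and has bounded
energy (7) verbatim. No delta of substance: no «wrong problem» axis.
[cite: FeffermanClay2006, statement (A), CMI offprint p. 2] -/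
theorem clay_of_claimed (h : ClaimedTheorem) : ClayVariants.clayR3.Regularity := by
  intro ν hν u₀ hu₀ hdiv hdecay
  obtain ⟨u, p, hsol, h0, hE⟩ := h ν hν u₀ (isDatum_of_clay hu₀ hdiv hdecay)
  obtain ⟨hns, hsu, hsp⟩ :=
    (isNavierStokesSolution_and_smooth_iff (ν := ν) (f := 0) (u₀ := u₀) (u := u) (p := p)).2
      ⟨hsol.isClassical, h0⟩
  exact ⟨u, p, hsu, hsp, hns, hE⟩

/-! ### Scaling rigidity of the load-bearing display (47) -/

/-- Chain rule for a homothety, in norm: `‖Dᵏ[ψ(b ·)](x)‖ ≤ |b|ᵏ ‖Dᵏψ(bx)‖` (`b ≠ 0`); the proof of the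
tree's `KNSSLocalSmoothingHolds.norm_iteratedFDeriv_comp_smul_le`, inlined to keep the import cone small.
[cite: Chadwick2023, §8 p.23 (scaling check of (47))] -/
private theorem norm_iteratedFDeriv_comp_smul_le
    (ψ : EuclideanSpace ℝ (Fin 3) → EuclideanSpace ℝ (Fin 3)) {b : ℝ} (hb : b ≠ 0) (k : ℕ)
    (x : EuclideanSpace ℝ (Fin 3)) :
    ‖iteratedFDeriv ℝ k (fun y => ψ (b • y)) x‖ ≤ |b| ^ k * ‖iteratedFDeriv ℝ k ψ (b • x)‖ := by
  set e : EuclideanSpace ℝ (Fin 3) ≃L[ℝ] EuclideanSpace ℝ (Fin 3) :=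
    ContinuousLinearEquiv.equivOfInverse (b • ContinuousLinearMap.id ℝ (EuclideanSpace ℝ (Fin 3)))
      (b⁻¹ • ContinuousLinearMap.id ℝ (EuclideanSpace ℝ (Fin 3))) (fun y => by simp [smul_smul, hb])
      (fun y => by simp [smul_smul, hb]) with he
  have hee : ∀ y, e y = b • y := fun y => rfl
  have hcomp : (fun y => ψ (b • y)) = ψ ∘ e := rfl
  have h := e.iteratedFDerivWithin_comp_right ψ uniqueDiffOn_univ (mem_univ (e x)) k
  simp only [preimage_univ, iteratedFDerivWithin_univ] at h
  rw [hcomp, h, hee x, mul_comm]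
  refine (ContinuousMultilinearMap.norm_compContinuousLinearMap_le _ _).trans ?_
  rw [Finset.prod_const, Finset.card_univ, Fintype.card_fin]
  refine mul_le_mul_of_nonneg_left (pow_le_pow_left₀ (norm_nonneg _) ?_ k) (norm_nonneg _)
  refine ContinuousLinearMap.opNorm_le_bound _ (abs_nonneg b) fun y => ?_
  rw [ContinuousLinearEquiv.coe_coe, hee y, norm_smul, Real.norm_eq_abs]

/-- **The data class is invariant under the Navier–Stokes dilation** `v ↦ c v(c ·)`, `c > 0`: stokeslet
decay of all derivatives is preserved (with `K ↦ max(1,c⁻¹)^{3+n} c^{1+n} K`).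
[cite: Chadwick2023, Theorem 1 p.5 (data class), §8 p.23] -/
theorem HasStokesletDecay.dilate {v : EuclideanSpace ℝ (Fin 3) → EuclideanSpace ℝ (Fin 3)}
    (hv : HasStokesletDecay v) (hvs : ContDiff ℝ ∞ v) {c : ℝ} (hc : 0 < c) :
    HasStokesletDecay (fun x => c • v (c • x)) := by
  intro n
  obtain ⟨K, hK⟩ := hv n
  set m : ℝ := max 1 c⁻¹ with hm
  have hm1 : 1 ≤ m := le_max_left _ _
  have hm0 : 0 ≤ m := zero_le_one.trans hm1
  have hK0 : 0 ≤ max K 0 := le_max_right _ _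
  refine ⟨m ^ (3 + n) * (|c| * |c| ^ n) * max K 0, fun x => ?_⟩
  -- the derivative of `c • (v ∘ (c • ·))`
  have hcomp : ContDiff ℝ ∞ (fun y : EuclideanSpace ℝ (Fin 3) => v (c • y)) :=
    hvs.comp (contDiff_const_smul c)
  have h1 : iteratedFDeriv ℝ n (fun y => c • v (c • y)) x = c • iteratedFDeriv ℝ n (fun y => v (c • y)) x :=
    iteratedFDeriv_const_smul_apply' ((hcomp.of_le (by exact_mod_cast le_top)).contDiffAt)
  have h2 : ‖iteratedFDeriv ℝ n (fun y => c • v (c • y)) x‖ ≤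
      |c| * |c| ^ n * ‖iteratedFDeriv ℝ n v (c • x)‖ := by
    rw [h1, norm_smul, Real.norm_eq_abs, mul_assoc]
    exact mul_le_mul_of_nonneg_left (norm_iteratedFDeriv_comp_smul_le v hc.ne' n x) (abs_nonneg c)
  -- the weight: `1 + ‖x‖ ≤ m (1 + ‖c • x‖)`
  have hw : 1 + ‖x‖ ≤ m * (1 + ‖c • x‖) := by
    rw [norm_smul, Real.norm_eq_abs, abs_of_pos hc]
    have : ‖x‖ ≤ m * (c * ‖x‖) := by
      have hmc : 1 ≤ m * c := by
        have : c⁻¹ * c = 1 := inv_mul_cancel₀ hc.ne'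
        nlinarith [le_max_right (1:ℝ) c⁻¹, norm_nonneg x]
      nlinarith [norm_nonneg x]
    nlinarith
  have hw' : (1 + ‖x‖) ^ (3 + n) ≤ m ^ (3 + n) * (1 + ‖c • x‖) ^ (3 + n) := by
    rw [← mul_pow]
    exact pow_le_pow_left₀ (by positivity) hw _
  have hKx : (1 + ‖c • x‖) ^ (3 + n) * ‖iteratedFDeriv ℝ n v (c • x)‖ ≤ max K 0 :=
    (hK (c • x)).trans (le_max_left _ _)
  calc (1 + ‖x‖) ^ (3 + n) * ‖iteratedFDeriv ℝ n (fun y => c • v (c • y)) x‖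
      ≤ (m ^ (3 + n) * (1 + ‖c • x‖) ^ (3 + n)) * (|c| * |c| ^ n * ‖iteratedFDeriv ℝ n v (c • x)‖) :=
        mul_le_mul hw' h2 (norm_nonneg _) (by positivity)
    _ = m ^ (3 + n) * (|c| * |c| ^ n) * ((1 + ‖c • x‖) ^ (3 + n) * ‖iteratedFDeriv ℝ n v (c • x)‖) := by
        ring
    _ ≤ m ^ (3 + n) * (|c| * |c| ^ n) * max K 0 :=
        mul_le_mul_of_nonneg_left hKx (by positivity)

/-- The dilate of a time slab: `(c² ·)⁻¹' [t₀, t₀ + T] = [t₀/c², t₀/c² + T/c²]`. [cite: Chadwick2023, §8 p.23] -/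
theorem preimage_slab {c : ℝ} (hc : 0 < c) (t₀ T : ℝ) :
    (fun t => c ^ 2 * t) ⁻¹' Icc t₀ (t₀ + T) = Icc (t₀ / c ^ 2) (t₀ / c ^ 2 + T / c ^ 2) := by
  have hc2 : 0 < c ^ 2 := by positivity
  ext t
  simp only [mem_preimage, mem_Icc]
  rw [← add_div, div_le_iff₀ hc2, le_div_iff₀ hc2]
  constructor <;> rintro ⟨h1, h2⟩ <;> constructor <;> linarith [mul_comm t (c ^ 2)]

/-- **The ansatz class is invariant under the Navier–Stokes dilation** `(u, p) ↦ (c u(c²t, cx),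
c² p(c²t, cx))` at fixed viscosity (tree: `IsClassicalNSSolutionOn.nsRescale_holds`, Leray 1934 §20),
the decay clause by `HasStokesletDecay.dilate`. [cite: Chadwick2023, Lemma 1 pp.5–6 (ansatz class)] -/
theorem IsSolutionOn.dilate {S : Set ℝ} {ν : ℝ}
    {u : ℝ → EuclideanSpace ℝ (Fin 3) → EuclideanSpace ℝ (Fin 3)} {p : ℝ → EuclideanSpace ℝ (Fin 3) → ℝ}
    (h : IsSolutionOn S ν u p) {c : ℝ} (hc : 0 < c) :
    IsSolutionOn ((fun t => c ^ 2 * t) ⁻¹' S) ν (nsRescale c u) (nsRescalePressure c p) := by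
  refine ⟨?_, fun t ht => ?_⟩
  · have key := IsClassicalNSSolutionOn.nsRescale_holds h.isClassical hc
    rwa [nsRescaleForce_zero] at key
  · have ht' : c ^ 2 * t ∈ S := ht
    have hdec := (h.decay _ ht').dilate (h.isClassical.contDiff_velocity ht') hc
    have heq : nsRescale c u t = fun x => c • u (c ^ 2 * t) (c • x) := by
      funext x; rw [nsRescale_apply]
    rw [heq]
    exact hdec

/-- Lagrangian paths dilate to Lagrangian paths: `X_c(t) = c⁻¹ X(c²t)` is a path of `c u(c²t, cx)`.
[cite: Chadwick2023, Lemma 2 p.7 (x^L)] -/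
theorem IsTrajectoryOn.dilate {u : ℝ → EuclideanSpace ℝ (Fin 3) → EuclideanSpace ℝ (Fin 3)}
    {S : Set ℝ} {X : ℝ → EuclideanSpace ℝ (Fin 3)} (hX : IsTrajectoryOn u S X) {c : ℝ} (hc : 0 < c) :
    IsTrajectoryOn (nsRescale c u) ((fun t => c ^ 2 * t) ⁻¹' S) (fun t => c⁻¹ • X (c ^ 2 * t)) := by
  intro t ht
  have ht' : c ^ 2 * t ∈ S := ht
  have hg : HasDerivWithinAt (fun s : ℝ => c ^ 2 * s) (c ^ 2) ((fun t => c ^ 2 * t) ⁻¹' S) t := by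
    simpa using (hasDerivWithinAt_id t _).const_mul (c ^ 2)
  have hmaps : MapsTo (fun s : ℝ => c ^ 2 * s) ((fun t => c ^ 2 * t) ⁻¹' S) S := fun s hs => hs
  have hcomp := (hX _ ht').scomp t hg hmaps
  have hsm := hcomp.const_smul c⁻¹
  have hval : c⁻¹ • (c ^ 2 • u (c ^ 2 * t) (X (c ^ 2 * t))) =
      nsRescale c u t (c⁻¹ • X (c ^ 2 * t)) := by
    rw [nsRescale_apply, smul_smul, smul_smul, mul_inv_cancel₀ hc.ne', one_smul, sq, ← mul_assoc,
      inv_mul_cancel₀ hc.ne', one_mul]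
  rw [← hval]
  exact hsm

/-- **Scaling rigidity of (47).** If the load-bearing display `Step_3` holds (ONE constant for all
solutions of the ansatz class, as printed), then along EVERY Lagrangian path of EVERY solution of the
class on EVERY slab `[t₀, t₀+T]` (no smallness condition left) each velocity component is CONSTANT:
apply (47) to the dilates `c u(c²t, cx)` on `[t₀/c², (t₀+T)/c²]` — the right-hand side acquires the factor
`c⁻¹` — and let `c → ∞`. (So `Step_3` asserts `Du/Dt ≡ 0` in the class; the kernel refutation of
`Step_3` reduces to ONE solution of the class with non-constant velocity along one path.)
[cite: Chadwick2023, (47) p.23 = Lemma 2 (2) p.7] -/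
theorem step3_rigid (h3 : Step_3) :
    ∀ ν : ℝ, 0 < ν → ∀ t₀ T : ℝ, 0 ≤ t₀ → 0 < T →
      ∀ (u : ℝ → EuclideanSpace ℝ (Fin 3) → EuclideanSpace ℝ (Fin 3))
        (p : ℝ → EuclideanSpace ℝ (Fin 3) → ℝ), IsSolutionOn (Icc t₀ (t₀ + T)) ν u p →
        ∀ X : ℝ → EuclideanSpace ℝ (Fin 3), IsTrajectoryOn u (Icc t₀ (t₀ + T)) X →
          ∀ k : Fin 3, u (t₀ + T) (X (t₀ + T)) k = u t₀ (X t₀) k := by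
  obtain ⟨C, hC, ε₀, hε₀, h⟩ := h3
  intro ν hν t₀ T ht₀ hT u p hsol X hX k
  set a : ℝ := u (t₀ + T) (X (t₀ + T)) k with ha
  set b : ℝ := u t₀ (X t₀) k with hb
  -- the dilated instance of (47), for every `c ≥ c₀ := ν √T / ε₀`
  have key : ∀ c : ℝ, 0 < c → ν * Real.sqrt T / ε₀ ≤ c → c * |a - b| ≤ C * (ν * Real.sqrt T) * |b| := by
    intro c hc hcc
    have hc2 : 0 < c ^ 2 := by positivity
    have hsol' : IsSolutionOn (Icc (t₀ / c ^ 2) (t₀ / c ^ 2 + T / c ^ 2)) ν (nsRescale c u)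
        (nsRescalePressure c p) := by
      rw [← preimage_slab hc]; exact hsol.dilate hc
    have hX' : IsTrajectoryOn (nsRescale c u) (Icc (t₀ / c ^ 2) (t₀ / c ^ 2 + T / c ^ 2))
        (fun t => c⁻¹ • X (c ^ 2 * t)) := by
      rw [← preimage_slab hc]; exact hX.dilate hc
    have hsqrt : Real.sqrt (T / c ^ 2) = Real.sqrt T / c := by
      rw [Real.sqrt_div' T hc2.le, Real.sqrt_sq hc.le]
    have hsmall : ν * Real.sqrt (T / c ^ 2) ≤ ε₀ := by
      rw [hsqrt, ← mul_div_assoc, div_le_iff₀ hc]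
      have hcc' := hcc
      rw [div_le_iff₀ hε₀] at hcc'
      linarith
    have h47 := h ν hν (t₀ / c ^ 2) (T / c ^ 2) (div_nonneg ht₀ hc2.le) (div_pos hT hc2) hsmall
      (nsRescale c u) (nsRescalePressure c p) hsol' (fun t => c⁻¹ • X (c ^ 2 * t)) hX' k
    -- evaluate the dilated quantities
    have e1 : c ^ 2 * (t₀ / c ^ 2 + T / c ^ 2) = t₀ + T := by field_simp
    have e0 : c ^ 2 * (t₀ / c ^ 2) = t₀ := by field_simp
    have hA : nsRescale c u (t₀ / c ^ 2 + T / c ^ 2) (c⁻¹ • X (c ^ 2 * (t₀ / c ^ 2 + T / c ^ 2))) k =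
        c * a := by
      rw [nsRescale_apply, smul_smul, mul_inv_cancel₀ hc.ne', one_smul, e1, PiLp.smul_apply,
        smul_eq_mul]
    have hB : nsRescale c u (t₀ / c ^ 2) (c⁻¹ • X (c ^ 2 * (t₀ / c ^ 2))) k = c * b := by
      rw [nsRescale_apply, smul_smul, mul_inv_cancel₀ hc.ne', one_smul, e0, PiLp.smul_apply,
        smul_eq_mul]
    rw [hA, hB, hsqrt] at h47
    have hlhs : |c * a - c * b| = c * |a - b| := by
      rw [← mul_sub, abs_mul, abs_of_pos hc]
    have hrhs : C * (ν * (Real.sqrt T / c)) * |c * b| = C * (ν * Real.sqrt T) * |b| := by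
      rw [abs_mul, abs_of_pos hc]; field_simp
    rw [hlhs, hrhs] at h47
    exact h47
  -- let `c → ∞`
  by_contra hab
  have hd : 0 < |a - b| := abs_pos.mpr (sub_ne_zero.mpr hab)
  set M : ℝ := C * (ν * Real.sqrt T) * |b| with hM
  have hM0 : 0 ≤ M := by rw [hM]; positivity
  set c : ℝ := max (ν * Real.sqrt T / ε₀ + 1) ((M + 1) / |a - b|) with hcdef
  have hc0 : 0 < c := by
    have : 0 < ν * Real.sqrt T / ε₀ + 1 := by positivity
    exact lt_of_lt_of_le this (le_max_left _ _)
  have hcc : ν * Real.sqrt T / ε₀ ≤ c := by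
    have : ν * Real.sqrt T / ε₀ ≤ ν * Real.sqrt T / ε₀ + 1 := by linarith
    exact this.trans (le_max_left _ _)
  have h1 := key c hc0 hcc
  have h2 : (M + 1) / |a - b| ≤ c := le_max_right _ _
  have h3 : M + 1 ≤ c * |a - b| := by
    rw [div_le_iff₀ hd] at h2; linarith
  linarith


/-! ### The referee's charitable retypes of (47) (RETYPE.md §2, ns-claims-ref-2 g2) and their kernel faces -/

/-- **R#1 — (47) with SOLUTION-DEPENDENT constants** (RETYPE §2 R#1: "constants depending on the solution /
a reference length"): for every viscosity and every slab with `ν√T ≤ ε₀` and every solution of the ansatz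
class there is SOME `C ≥ 0` (depending on `ν`, the slab and the solution, not on the path or the
component) with the componentwise display (47) along every Lagrangian path. Weaker than `Step_3`
(`step3R1_of_step3`); it still transports the zeros of every velocity component along the flow
(`step3R1_zero_transport`, the referee's mechanism (β)). A retype, not a printed statement.
[cite: Chadwick2023, (47) p.23 (charitable reading R#1)] -/
def Step_3R1 : Prop :=
  ∃ ε₀ : ℝ, 0 < ε₀ ∧ ∀ ν : ℝ, 0 < ν → ∀ t₀ T : ℝ, 0 ≤ t₀ → 0 < T → ν * Real.sqrt T ≤ ε₀ →
    ∀ (u : ℝ → EuclideanSpace ℝ (Fin 3) → EuclideanSpace ℝ (Fin 3)) (p : ℝ → EuclideanSpace ℝ (Fin 3) → ℝ),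
      IsSolutionOn (Icc t₀ (t₀ + T)) ν u p →
      ∃ C : ℝ, 0 ≤ C ∧ ∀ X : ℝ → EuclideanSpace ℝ (Fin 3), IsTrajectoryOn u (Icc t₀ (t₀ + T)) X →
        ∀ k : Fin 3,
          |u (t₀ + T) (X (t₀ + T)) k - u t₀ (X t₀) k| ≤ C * (ν * Real.sqrt T) * |u t₀ (X t₀) k|

/-- **R#2 — (47) in VECTOR-NORM form, universal constant** (RETYPE §2 R#2):
`‖u(t₀+T, X(t₀+T)) − u(t₀, X(t₀))‖ ≤ C ν√T ‖u(t₀, X(t₀))‖`. Implied by `Step_3` (`step3R2_of_step3`) and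
subject to the same scaling rigidity (`step3R2_rigid`). A retype, not a printed statement.
[cite: Chadwick2023, (47) p.23 (charitable reading R#2)] -/
def Step_3R2 : Prop :=
  ∃ C : ℝ, 0 ≤ C ∧ ∃ ε₀ : ℝ, 0 < ε₀ ∧ ∀ ν : ℝ, 0 < ν → ∀ t₀ T : ℝ, 0 ≤ t₀ → 0 < T →
    ν * Real.sqrt T ≤ ε₀ →
    ∀ (u : ℝ → EuclideanSpace ℝ (Fin 3) → EuclideanSpace ℝ (Fin 3)) (p : ℝ → EuclideanSpace ℝ (Fin 3) → ℝ),
      IsSolutionOn (Icc t₀ (t₀ + T)) ν u p →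
      ∀ X : ℝ → EuclideanSpace ℝ (Fin 3), IsTrajectoryOn u (Icc t₀ (t₀ + T)) X →
        ‖u (t₀ + T) (X (t₀ + T)) - u t₀ (X t₀)‖ ≤ C * (ν * Real.sqrt T) * ‖u t₀ (X t₀)‖

/-- `Step_3 → Step_3R1` (a uniform constant is in particular a solution-dependent one).
[cite: Chadwick2023, (47) p.23] -/
theorem step3R1_of_step3 (h : Step_3) : Step_3R1 := by
  obtain ⟨C, hC, ε₀, hε₀, h⟩ := h
  exact ⟨ε₀, hε₀, fun ν hν t₀ T ht₀ hT hε u p hsol =>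
    ⟨C, hC, fun X hX k => h ν hν t₀ T ht₀ hT hε u p hsol X hX k⟩⟩

/-- **Mechanism (β), kernel face: zeros of every velocity component are transported by the flow** under
R#1 (hence under `Step_3`): if `u_k` vanishes at the Lagrangian point at time `t₀`, it vanishes at the
transported point at time `t₀ + T` (`ν√T ≤ ε₀`). A class solution whose `k`-th velocity component
vanishes at a point of non-zero material acceleration refutes it on paper (RETYPE §1 (β)).
[cite: Chadwick2023, (47) p.23 (charitable reading R#1)] -/
theorem step3R1_zero_transport (h : Step_3R1) :
    ∃ ε₀ : ℝ, 0 < ε₀ ∧ ∀ ν : ℝ, 0 < ν → ∀ t₀ T : ℝ, 0 ≤ t₀ → 0 < T → ν * Real.sqrt T ≤ ε₀ →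
      ∀ (u : ℝ → EuclideanSpace ℝ (Fin 3) → EuclideanSpace ℝ (Fin 3))
        (p : ℝ → EuclideanSpace ℝ (Fin 3) → ℝ), IsSolutionOn (Icc t₀ (t₀ + T)) ν u p →
        ∀ X : ℝ → EuclideanSpace ℝ (Fin 3), IsTrajectoryOn u (Icc t₀ (t₀ + T)) X →
          ∀ k : Fin 3, u t₀ (X t₀) k = 0 → u (t₀ + T) (X (t₀ + T)) k = 0 := by
  obtain ⟨ε₀, hε₀, h⟩ := h
  refine ⟨ε₀, hε₀, fun ν hν t₀ T ht₀ hT hε u p hsol X hX k hk => ?_⟩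
  obtain ⟨C, -, hC⟩ := h ν hν t₀ T ht₀ hT hε u p hsol
  have := hC X hX k
  rw [hk, abs_zero, mul_zero, sub_zero] at this
  exact abs_eq_zero.mp (le_antisymm this (abs_nonneg _))

/-- From the componentwise display to the vector-norm form: `|a_k − b_k| ≤ c|b_k|` (`k = 1,2,3`, `c ≥ 0`)
gives `‖a − b‖ ≤ c‖b‖`. Plumbing. [cite: Chadwick2023, (47) p.23] -/
theorem norm_sub_le_of_componentwise {a b : EuclideanSpace ℝ (Fin 3)} {c : ℝ} (hc : 0 ≤ c)
    (h : ∀ k : Fin 3, |a k - b k| ≤ c * |b k|) : ‖a - b‖ ≤ c * ‖b‖ := by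
  rw [EuclideanSpace.norm_eq (a - b), EuclideanSpace.norm_eq b]
  have hsum : ∑ k : Fin 3, ‖(a - b) k‖ ^ 2 ≤ ∑ k : Fin 3, (c * ‖b k‖) ^ 2 := by
    refine Finset.sum_le_sum fun k _ => ?_
    have hk : ‖(a - b) k‖ ≤ c * ‖b k‖ := by
      simpa [Real.norm_eq_abs] using h k
    exact pow_le_pow_left₀ (norm_nonneg _) hk 2
  have hfac : ∑ k : Fin 3, (c * ‖b k‖) ^ 2 = c ^ 2 * ∑ k : Fin 3, ‖b k‖ ^ 2 := by
    rw [Finset.mul_sum]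
    refine Finset.sum_congr rfl fun k _ => ?_
    ring
  calc Real.sqrt (∑ k : Fin 3, ‖(a - b) k‖ ^ 2)
      ≤ Real.sqrt (c ^ 2 * ∑ k : Fin 3, ‖b k‖ ^ 2) := Real.sqrt_le_sqrt (hfac ▸ hsum)
    _ = c * Real.sqrt (∑ k : Fin 3, ‖b k‖ ^ 2) := by
        rw [Real.sqrt_mul (sq_nonneg _), Real.sqrt_sq hc]

/-- `Step_3 → Step_3R2`. [cite: Chadwick2023, (47) p.23] -/
theorem step3R2_of_step3 (h : Step_3) : Step_3R2 := by
  obtain ⟨C, hC, ε₀, hε₀, h⟩ := h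
  refine ⟨C, hC, ε₀, hε₀, fun ν hν t₀ T ht₀ hT hε u p hsol X hX => ?_⟩
  exact norm_sub_le_of_componentwise (mul_nonneg hC (mul_nonneg hν.le (Real.sqrt_nonneg _)))
    (h ν hν t₀ T ht₀ hT hε u p hsol X hX)

/-- **Scaling rigidity of R#2** (same dilation argument as `step3_rigid`): the vector-norm form with one
constant forces the velocity VECTOR to be constant along every Lagrangian path of every class solution.
[cite: Chadwick2023, (47) p.23 (charitable reading R#2)] -/
theorem step3R2_rigid (h3 : Step_3R2) :
    ∀ ν : ℝ, 0 < ν → ∀ t₀ T : ℝ, 0 ≤ t₀ → 0 < T →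
      ∀ (u : ℝ → EuclideanSpace ℝ (Fin 3) → EuclideanSpace ℝ (Fin 3))
        (p : ℝ → EuclideanSpace ℝ (Fin 3) → ℝ), IsSolutionOn (Icc t₀ (t₀ + T)) ν u p →
        ∀ X : ℝ → EuclideanSpace ℝ (Fin 3), IsTrajectoryOn u (Icc t₀ (t₀ + T)) X →
          u (t₀ + T) (X (t₀ + T)) = u t₀ (X t₀) := by
  obtain ⟨C, hC, ε₀, hε₀, h⟩ := h3
  intro ν hν t₀ T ht₀ hT u p hsol X hX
  set a : EuclideanSpace ℝ (Fin 3) := u (t₀ + T) (X (t₀ + T)) with ha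
  set b : EuclideanSpace ℝ (Fin 3) := u t₀ (X t₀) with hb
  have key : ∀ c : ℝ, 0 < c → ν * Real.sqrt T / ε₀ ≤ c → c * ‖a - b‖ ≤ C * (ν * Real.sqrt T) * ‖b‖ := by
    intro c hc hcc
    have hc2 : 0 < c ^ 2 := by positivity
    have hsol' : IsSolutionOn (Icc (t₀ / c ^ 2) (t₀ / c ^ 2 + T / c ^ 2)) ν (nsRescale c u)
        (nsRescalePressure c p) := by
      rw [← preimage_slab hc]; exact hsol.dilate hc
    have hX' : IsTrajectoryOn (nsRescale c u) (Icc (t₀ / c ^ 2) (t₀ / c ^ 2 + T / c ^ 2))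
        (fun t => c⁻¹ • X (c ^ 2 * t)) := by
      rw [← preimage_slab hc]; exact hX.dilate hc
    have hsqrt : Real.sqrt (T / c ^ 2) = Real.sqrt T / c := by
      rw [Real.sqrt_div' T hc2.le, Real.sqrt_sq hc.le]
    have hsmall : ν * Real.sqrt (T / c ^ 2) ≤ ε₀ := by
      rw [hsqrt, ← mul_div_assoc, div_le_iff₀ hc]
      have hcc' := hcc
      rw [div_le_iff₀ hε₀] at hcc'
      linarith
    have h47 := h ν hν (t₀ / c ^ 2) (T / c ^ 2) (div_nonneg ht₀ hc2.le) (div_pos hT hc2) hsmall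
      (nsRescale c u) (nsRescalePressure c p) hsol' (fun t => c⁻¹ • X (c ^ 2 * t)) hX'
    have e1 : c ^ 2 * (t₀ / c ^ 2 + T / c ^ 2) = t₀ + T := by field_simp
    have e0 : c ^ 2 * (t₀ / c ^ 2) = t₀ := by field_simp
    have hA : nsRescale c u (t₀ / c ^ 2 + T / c ^ 2) (c⁻¹ • X (c ^ 2 * (t₀ / c ^ 2 + T / c ^ 2))) =
        c • a := by
      rw [nsRescale_apply, smul_smul, mul_inv_cancel₀ hc.ne', one_smul, e1]
    have hB : nsRescale c u (t₀ / c ^ 2) (c⁻¹ • X (c ^ 2 * (t₀ / c ^ 2))) = c • b := by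
      rw [nsRescale_apply, smul_smul, mul_inv_cancel₀ hc.ne', one_smul, e0]
    rw [hA, hB, hsqrt, ← smul_sub, norm_smul, norm_smul, Real.norm_eq_abs, abs_of_pos hc] at h47
    have hrhs : C * (ν * (Real.sqrt T / c)) * (c * ‖b‖) = C * (ν * Real.sqrt T) * ‖b‖ := by
      field_simp
    rw [hrhs] at h47
    exact h47
  by_contra hab
  have hd : 0 < ‖a - b‖ := norm_pos_iff.mpr (sub_ne_zero.mpr hab)
  set M : ℝ := C * (ν * Real.sqrt T) * ‖b‖ with hM
  set c : ℝ := max (ν * Real.sqrt T / ε₀ + 1) ((M + 1) / ‖a - b‖) with hcdef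
  have hc0 : 0 < c := by
    have : 0 < ν * Real.sqrt T / ε₀ + 1 := by positivity
    exact lt_of_lt_of_le this (le_max_left _ _)
  have hcc : ν * Real.sqrt T / ε₀ ≤ c := by
    have : ν * Real.sqrt T / ε₀ ≤ ν * Real.sqrt T / ε₀ + 1 := by linarith
    exact this.trans (le_max_left _ _)
  have h1 := key c hc0 hcc
  have h2 : (M + 1) / ‖a - b‖ ≤ c := le_max_right _ _
  have h3 : M + 1 ≤ c * ‖a - b‖ := by
    rw [div_le_iff₀ hd] at h2; linarith
  linarith

end Literature.Claims.NS.Chadwick2023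

end

-- WHAT THIS IS NOT: not a claim about NS regularity or blow-up; not a claim about any author beyond the
-- typed locator.
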